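import Mathlib
import HarnessLib
import Summits.ResolutionOfSingularities.ResolutionOfSingularities.Theorems.WildQuotientsWildQuotientResolutionS1aGraphTailKillsIn

/-!
# S1a — R4e-rational: the graph-tail class INHABITS THE RESEARCH STUB (`exists_reachLowerF_initial_of_graphTail`) and the census coordinates

[OURS · L1 W4.5c · lead-1 g17; plan-1 RULING R-F15s (3) corollaries of ★★★ ✓`graphTail_killsIn_two`: the conclusion of `ReachLowerInF(X)` at the initial model for
every node atlas (✓`exists_reachLowerF_of_killsIn_datum`), and the CENSUS COORDINATES `σ: x₁ ↦ x₁ + x₀, x₂ ↦ x₂ + x₀, x₃ ↦ x₃ + (x₂ − x₁) − g(x₁)` via the linear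
recoordination `u = x₂ − x₁` (✓`FreeModel.exists_linShear`, pattern ✓`tmonoCensus_killsIn_two`)] — NOT statements of the manuscript; counted 0; AI-level work, weaker
than expert review. Crux stmt-ResolutionOfSingularities-17941 `CyclicQuotientFourfolds`, line `s1a-logminvertex` v13 (`stub_reachLowerInFX`).
-/

set_option linter.dupNamespace false

noncomputable section

open CategoryTheory Limits AlgebraicGeometry TopologicalSpace Topology Opposite MvPolynomial
open Literature.AlgebraicGeometry.Resolution Literature.AlgebraicGeometry.RelativeSpec
open Summit.ResolutionOfSingularities.ResolutionOfSingularities.Theorems.WildQuotientResolution.S1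
open Summit.ResolutionOfSingularities.ResolutionOfSingularities.Theorems.WildQuotientResolution.S1.NodeAtlas
open Summit.ResolutionOfSingularities.ResolutionOfSingularities.Theorems.WildQuotientResolution.S1.NpFrame
open Summit.ResolutionOfSingularities.ResolutionOfSingularities.Theorems.WildQuotientResolution.S1.FreeModel

namespace Summit.ResolutionOfSingularities.ResolutionOfSingularities.Theorems.WildQuotientResolution.S1.GameFrame.GModel

variable {p : ℕ} {X' X₁ : Scheme.{0}} {q : X' ⟶ X₁} {G : Type} [Group G] {ρ : G →* Aut X'} {g₀ : G}

/-- ★★★ **the graph-tail class (rational critical points) inhabits the research stub**: for every node atlas `𝔄₀` on the initial model the conclusion of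
`ReachLowerInF(X)` holds at `(M₀, 𝔄₀)`. [OURS · L1 W4.5c · R4e-rational; NOT a statement of the manuscript] -/
theorem exists_reachLowerF_initial_of_graphTail [Finite G] (hp : p.Prime) (hG : ∀ g : G, g ∈ Subgroup.zpowers g₀) (hg₀ : g₀ ^ p = 1)
    (hq : ∀ g : G, (ρ g).hom ≫ q = q) [IsIntegral X'] [IsLocallyNoetherian X'] [X'.IsSeparated] [IsAffine X']
    {k' : Type} [Field k'] (φ : X₁ ⟶ Spec (.of k')) [IsSeparated φ] [LocallyOfFiniteType φ] [IsFinite q]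
    {k : Type} [Field k] [Fact p.Prime] [CharP k p]
    (g : Polynomial k) {r : ℕ} (hr : 0 < r) (α : Fin r → k) (hα : Function.Injective α) (m : Fin r → ℕ) (c : k) (hc : c ≠ 0)
    (hg' : Polynomial.derivative g = Polynomial.C c * ∏ j, (Polynomial.X - Polynomial.C (α j)) ^ m j)
    (wloc : Fin r → Polynomial k) (hwloc : ∀ i, g.comp (Polynomial.X + Polynomial.C (α i)) - Polynomial.C (g.eval (α i)) = Polynomial.X ^ (m i + 1) * wloc i)
    (σ : MvPolynomial (Fin 4) k ≃+* MvPolynomial (Fin 4) k) (hC : ∀ a : k, σ (C a) = C a)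
    (h0 : σ (X 0) = X 0) (h1 : σ (X 1) = X 1 + X 0) (h2 : σ (X 2) = X 2) (h3 : σ (X 3) = X 3 + (X 2 - Polynomial.aeval (X 1 : MvPolynomial (Fin 4) k) g))
    (e : Γ(X', ⊤) ≃+* MvPolynomial (Fin 4) k)
    (hστ : ∀ t : Γ(X', ⊤), e ((ρ g₀⁻¹).hom.appLE ⊤ ⊤ (by rw [Scheme.Hom.preimage_top]) t) = σ (e t))
    (h₀ : NodeAtlas p (⟨ρ, hq⟩ : ActionOver q G) g₀) (𝔄₀ : NodeAtlasData p (GModel.initial hq h₀).act g₀) :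
    ∃ P : ∀ M : GModel p q G ρ g₀, NodeAtlasData p M.act g₀ → Prop,
      P (GModel.initial hq h₀) 𝔄₀ ∧ ∀ (M : GModel p q G ρ g₀) (𝔄 : NodeAtlasData p M.act g₀), P M 𝔄 → ¬ M.Terminal →
        ∃ n : ℕ, TreeF P (fun N 𝔅 => LexLTF N 𝔅 M 𝔄) n M 𝔄 :=
  exists_reachLowerF_of_killsIn_datum hp hG φ (GModel.initial hq h₀) 𝔄₀ (graphTail_killsIn_two hp hG hg₀ hq φ g hr α hα m c hc hg' wloc hwloc σ hC h0 h1 h2 h3 e hστ h₀)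

/-- ★★★ **the graph tail in the CENSUS COORDINATES**: σ: `x₁ ↦ x₁ + x₀`, `x₂ ↦ x₂ + x₀`, `x₃ ↦ x₃ + (x₂ − x₁) − g(x₁)` ⇒ `KillsIn 2 (GModel.initial hq h₀)`, by the
LINEAR RECOORDINATION `u = x₂ − x₁` (✓`FreeModel.exists_linShear`, absorbed into `e`). [OURS · L1 W4.5c · R4e-rational; NOT a statement of the manuscript] -/
theorem graphTailCensus_killsIn_two [Finite G] (hp : p.Prime) (hG : ∀ g : G, g ∈ Subgroup.zpowers g₀) (hg₀ : g₀ ^ p = 1)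
    (hq : ∀ g : G, (ρ g).hom ≫ q = q) [IsIntegral X'] [IsLocallyNoetherian X'] [X'.IsSeparated] [IsAffine X']
    {k' : Type} [Field k'] (φ : X₁ ⟶ Spec (.of k')) [IsSeparated φ] [LocallyOfFiniteType φ] [IsFinite q]
    {k : Type} [Field k] [Fact p.Prime] [CharP k p]
    (g : Polynomial k) {r : ℕ} (hr : 0 < r) (α : Fin r → k) (hα : Function.Injective α) (m : Fin r → ℕ) (c : k) (hc : c ≠ 0)
    (hg' : Polynomial.derivative g = Polynomial.C c * ∏ j, (Polynomial.X - Polynomial.C (α j)) ^ m j)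
    (wloc : Fin r → Polynomial k) (hwloc : ∀ i, g.comp (Polynomial.X + Polynomial.C (α i)) - Polynomial.C (g.eval (α i)) = Polynomial.X ^ (m i + 1) * wloc i)
    (σ : MvPolynomial (Fin 4) k ≃+* MvPolynomial (Fin 4) k) (hC : ∀ a : k, σ (C a) = C a)
    (h0 : σ (X 0) = X 0) (h1 : σ (X 1) = X 1 + X 0) (h2 : σ (X 2) = X 2 + X 0)
    (h3 : σ (X 3) = X 3 + ((X 2 - X 1) - Polynomial.aeval (X 1 : MvPolynomial (Fin 4) k) g))
    (e : Γ(X', ⊤) ≃+* MvPolynomial (Fin 4) k)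
    (hστ : ∀ t : Γ(X', ⊤), e ((ρ g₀⁻¹).hom.appLE ⊤ ⊤ (by rw [Scheme.Hom.preimage_top]) t) = σ (e t))
    (h₀ : NodeAtlas p (⟨ρ, hq⟩ : ActionOver q G) g₀) :
    KillsIn 2 (GModel.initial (p := p) (g₀ := g₀) hq h₀) := by
  classical
  obtain ⟨γ, hγ2, hγ, hγ2', hγ'⟩ := FreeModel.exists_linShear k (1 : Fin 4) 2 (by decide) (1 : k) 1 one_ne_zero
  have hγ0 : γ (X 0) = X 0 := hγ 0 (by decide)
  have hγ1 : γ (X 1) = X 1 := hγ 1 (by decide)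
  have hγ3 : γ (X 3) = X 3 := hγ 3 (by decide)
  have hγ2'' : γ (X 2) = X 1 + X 2 := by rw [hγ2, C_1, one_mul, one_mul]
  have hγs2 : γ.symm (X 2) = X 2 - X 1 := by rw [hγ2', inv_one, C_1, one_mul, one_mul]
  have hγs0 : γ.symm (X 0) = X 0 := hγ' 0 (by decide)
  have hγs1 : γ.symm (X 1) = X 1 := hγ' 1 (by decide)
  have hγs3 : γ.symm (X 3) = X 3 := hγ' 3 (by decide)
  have hγg : γ (Polynomial.aeval (X 1 : MvPolynomial (Fin 4) k) g) = Polynomial.aeval (X 1 : MvPolynomial (Fin 4) k) g := by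
    rw [← Polynomial.aeval_algHom_apply, hγ1]
  let σ' : MvPolynomial (Fin 4) k ≃+* MvPolynomial (Fin 4) k := (γ.symm.toRingEquiv.trans σ).trans γ.toRingEquiv
  have hσ' : ∀ x, σ' x = γ (σ (γ.symm x)) := fun _ => rfl
  have hC' : ∀ a : k, σ' (C a) = C a := fun a => by
    rw [hσ', show γ.symm (C a) = C a from γ.symm.commutes a, hC, show γ (C a) = C a from γ.commutes a]
  have h0' : σ' (X 0) = X 0 := by rw [hσ', hγs0, h0, hγ0]
  have h1' : σ' (X 1) = X 1 + X 0 := by rw [hσ', hγs1, h1, map_add, hγ1, hγ0]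
  have h2' : σ' (X 2) = X 2 := by
    rw [hσ', hγs2, map_sub, h2, h1, map_sub, map_add, map_add, hγ2'', hγ1, hγ0]; ring
  have h3' : σ' (X 3) = X 3 + (X 2 - Polynomial.aeval (X 1 : MvPolynomial (Fin 4) k) g) := by
    rw [hσ', hγs3, h3, map_add, map_sub, map_sub, hγ3, hγ2'', hγ1, hγg]; ring
  let e' : Γ(X', ⊤) ≃+* MvPolynomial (Fin 4) k := e.trans γ.toRingEquiv
  have hστ' : ∀ t : Γ(X', ⊤), e' ((ρ g₀⁻¹).hom.appLE ⊤ ⊤ (by rw [Scheme.Hom.preimage_top]) t) = σ' (e' t) := fun t => by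
    change γ (e _) = γ (σ (γ.symm (γ (e t))))
    rw [hστ, γ.symm_apply_apply]
  exact graphTail_killsIn_two hp hG hg₀ hq φ g hr α hα m c hc hg' wloc hwloc σ' hC' h0' h1' h2' h3' e' hστ' h₀

/-- ★★★ **(census coordinates) the graph-tail datum inhabits the research stub.** [OURS · L1 W4.5c · R4e-rational; NOT a statement of the manuscript] -/
theorem exists_reachLowerF_initial_of_graphTailCensus [Finite G] (hp : p.Prime) (hG : ∀ g : G, g ∈ Subgroup.zpowers g₀) (hg₀ : g₀ ^ p = 1)
    (hq : ∀ g : G, (ρ g).hom ≫ q = q) [IsIntegral X'] [IsLocallyNoetherian X'] [X'.IsSeparated] [IsAffine X']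
    {k' : Type} [Field k'] (φ : X₁ ⟶ Spec (.of k')) [IsSeparated φ] [LocallyOfFiniteType φ] [IsFinite q]
    {k : Type} [Field k] [Fact p.Prime] [CharP k p]
    (g : Polynomial k) {r : ℕ} (hr : 0 < r) (α : Fin r → k) (hα : Function.Injective α) (m : Fin r → ℕ) (c : k) (hc : c ≠ 0)
    (hg' : Polynomial.derivative g = Polynomial.C c * ∏ j, (Polynomial.X - Polynomial.C (α j)) ^ m j)
    (wloc : Fin r → Polynomial k) (hwloc : ∀ i, g.comp (Polynomial.X + Polynomial.C (α i)) - Polynomial.C (g.eval (α i)) = Polynomial.X ^ (m i + 1) * wloc i)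
    (σ : MvPolynomial (Fin 4) k ≃+* MvPolynomial (Fin 4) k) (hC : ∀ a : k, σ (C a) = C a)
    (h0 : σ (X 0) = X 0) (h1 : σ (X 1) = X 1 + X 0) (h2 : σ (X 2) = X 2 + X 0)
    (h3 : σ (X 3) = X 3 + ((X 2 - X 1) - Polynomial.aeval (X 1 : MvPolynomial (Fin 4) k) g))
    (e : Γ(X', ⊤) ≃+* MvPolynomial (Fin 4) k)
    (hστ : ∀ t : Γ(X', ⊤), e ((ρ g₀⁻¹).hom.appLE ⊤ ⊤ (by rw [Scheme.Hom.preimage_top]) t) = σ (e t))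
    (h₀ : NodeAtlas p (⟨ρ, hq⟩ : ActionOver q G) g₀) (𝔄₀ : NodeAtlasData p (GModel.initial hq h₀).act g₀) :
    ∃ P : ∀ M : GModel p q G ρ g₀, NodeAtlasData p M.act g₀ → Prop,
      P (GModel.initial hq h₀) 𝔄₀ ∧ ∀ (M : GModel p q G ρ g₀) (𝔄 : NodeAtlasData p M.act g₀), P M 𝔄 → ¬ M.Terminal →
        ∃ n : ℕ, TreeF P (fun N 𝔅 => LexLTF N 𝔅 M 𝔄) n M 𝔄 :=
  exists_reachLowerF_of_killsIn_datum hp hG φ (GModel.initial hq h₀) 𝔄₀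
    (graphTailCensus_killsIn_two hp hG hg₀ hq φ g hr α hα m c hc hg' wloc hwloc σ hC h0 h1 h2 h3 e hστ h₀)

end Summit.ResolutionOfSingularities.ResolutionOfSingularities.Theorems.WildQuotientResolution.S1.GameFrame.GModel

end
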